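import Mathlib
import HarnessLib
import Summits.ValiantsHypothesis.ValiantsHypothesis.Theorems.MonotoneRestorationQP.Negative.OrbitRestorationFalseOfPolylogWidthVP
import Summits.ValiantsHypothesis.ValiantsHypothesis.Theorems.MonotoneRestorationMonotoneRestorationQPLinearWidthDefs
import Summits.ValiantsHypothesis.ValiantsHypothesis.Theorems.MonotoneRestorationMonotoneRestorationQPLinearWidthDeterminedVsNarrow
import Literature.ModelTheory.FiniteModelTheory.CkEquivHomCount

/-!
# Route MonotoneRestoration, crux `OrbitRestorationQP` (stmt-18293) / line `linear_width` of crux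
# `MonotoneRestorationQP` (stmt-15886) — THE LOSSLESS SIMPLE-GRAPH CUT OF L1, AND THE BRIDGE FROM THE
# REGISTERED TWO-SORTED GAP 2

Helper file (`--supports`), def-free.  The registered skeleton `Cruxes/MonotoneRestorationQP/Lines/linear_width.lean`
cuts L1 = `OrbitRestorationQP` as `WidthRestorationQP ∧ HomDeterminedVP` with the width hypothesis
`PolylogHomDetermined f` = determination by homomorphism polynomials of BIPARTITE (two-sorted) patterns of
treewidth `< (log₂ n + c)^c` at ALL COMPLEX points; only `⟸` of the advertised "L1 ⟺ …" is kernel-checked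
(`orbitRestorationQP_of_width`).  What the in-tree support pipeline actually extracts from the CONCLUSION of L1
(`not_qpOrbitSymmetric_of_polylogSeparating`, Dawar–Wilsenach Thm 5.1 + Support Theorem + Anderson–Dawar) is
ONE-SORTED, `0/1`, SIMPLE-GRAPH determination: `f m` takes equal values at the adjacency matrices of
`≡^{C^{(log₂ m + c)^c}}`-equivalent graphs on `Fin m` (tree `CkEquiv`, Hella's bijective pebble game).  This file

* `orbitRestorationQP_iff_simpleGraphCut` — proves the LOSSLESS cut in that currency:
  `L1 ⟺ W₁ ∧ H₁`, where `H₁` = "every matrix-symmetric `VP` family is EVENTUALLY `C^{polylog}`-determined on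
  simple graphs" (no arithmetic Cai–Fürer–Immerman family in characteristic `0`, separation form = the negation
  of `PolylogWidthVP`) and `W₁` = "eventual `C^{polylog}`-determination on simple graphs ⇒ quasi-polynomial
  orbits" (width-to-orbit restoration with the WEAKEST width hypothesis the conclusion forces);
* `eval_indicator_homPoly` — the dictionary lemma: the homomorphism polynomial `hom_{E,m}` of a bipartite
  multigraph pattern `E`, evaluated at the `0/1` adjacency matrix of a simple graph `X` on `Fin m`, is the
  number of graph homomorphisms `patternGraph E →g X` (Dwivedi–Pago–Seppelt 2026 eq. (1) at Boolean points);
* `homIndist_indicator_of_ckEquiv` — hence, by Dvořák's theorem (PROVED in the tree,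
  `Dvorak2010.card_hom_eq_of_ckEquiv`), `C^k`-equivalent simple graphs have `HomIndist m k`-indistinguishable
  adjacency matrices (the registered two-sorted relation restricted to Boolean symmetric points);
* `ckDetermined_of_polylogHomDetermined`, `simpleGraphHalf_of_homDeterminedVP`, `widthRestoration_of_simpleGraphW` —
  so the REGISTERED GAP 2 (`stub_homDeterminedVP`, unfolded verbatim) implies the lossless half `H₁` (with
  threshold `N = 0`), and the lossless circuit half `W₁` implies the registered `WidthRestorationQP`: the
  registered cut is sound (`MonotoneRestorationQPLinearWidth.orbitRestorationQP_of_width`, Glue file), its GAP 2 is a priori STRONGER than what L1 yields (two-sorted classes are coarser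
  than one-sorted ones; complex points are more than Boolean ones), and its width half a priori WEAKER than `W₁`;
* `simpleGraphHalf_of_polylogDegree` — the floor: matrix-symmetric families of polylogarithmic degree satisfy
  `H₁` with NO `VP` hypothesis (`DeterminedVsNarrow.polylogHomDetermined_of_polylogDegree` + the bridge).

Honest label: by-name glue + one dictionary lemma; no stub closed; L1, the cruxes and VP ≠ VNP NOT moved.
[cite: Dvorak2010, Thm 6; DawarWilsenach2025, Thm 5.1, §6; DwivediPagoSeppelt2026, eq. (1), Def. 3.2, Outlook Q3]
-/

-- `Summit.ValiantsHypothesis.ValiantsHypothesis.…` is the tree's mandated namespace (Sub = Summit).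
set_option linter.dupNamespace false

noncomputable section

namespace Summit.ValiantsHypothesis.ValiantsHypothesis.Theorems

namespace SimpleGraphCut

open Summit.ValiantsHypothesis.ValiantsHypothesis.Theses.MonotoneRestoration
open Literature.Computability.AlgebraicComplexity
open Literature.ModelTheory.FiniteModelTheory
open MonotoneRestorationQPLinearWidth
open MvPolynomial

/-! ### The dictionary: homomorphism polynomials at Boolean points count graph homomorphisms -/

/-- A product of `0/1` values over a multiset is the indicator that all of them are `1`. [folklore] -/
theorem prod_map_ite_one_zero {α : Type*} (E : Multiset α) (P : α → Prop) [DecidablePred P] :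
    (E.map fun e => (if P e then (1 : ℂ) else 0)).prod = if ∀ e ∈ E, P e then 1 else 0 := by
  induction E using Multiset.induction_on with
  | empty => simp
  | cons a s ih =>
    rw [Multiset.map_cons, Multiset.prod_cons, ih]
    by_cases ha : P a
    · simp [ha]
    · simp [ha]

/-- The graph homomorphisms `patternGraph E →g Γ` are in bijection with the pairs of vertex maps `(h₁, h₂)`
sending every pattern edge of `E` to an edge of `Γ` (glue / split the two maps along `Fin a ⊕ Fin b`); in
particular the two sets have the same cardinality. [folklore] -/
theorem natCard_hom_patternGraph {a b m : ℕ} (E : Multiset (Fin a × Fin b)) (Γ : SimpleGraph (Fin m)) :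
    Nat.card (patternGraph E →g Γ) =
      Nat.card {h : (Fin a → Fin m) × (Fin b → Fin m) // ∀ e ∈ E, Γ.Adj (h.1 e.1) (h.2 e.2)} := by
  refine Nat.card_congr
    { toFun := fun g => ⟨(g ∘ Sum.inl, g ∘ Sum.inr), fun e he => ?_⟩
      invFun := fun h =>
        { toFun := Sum.elim h.1.1 h.1.2
          map_rel' := ?_ }
      left_inv := fun g => by
        ext u
        cases u <;> rfl
      right_inv := fun h => by
        ext <;> rfl }
  · have hadj : (patternGraph E).Adj (Sum.inl e.1) (Sum.inr e.2) := by
      rw [patternGraph, SimpleGraph.fromRel_adj]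
      exact ⟨Sum.inl_ne_inr, Or.inl ⟨e, he, rfl, rfl⟩⟩
    exact g.map_rel hadj
  · rintro u v huv
    rw [patternGraph, SimpleGraph.fromRel_adj] at huv
    obtain ⟨-, ⟨p, hp, rfl, rfl⟩ | ⟨p, hp, rfl, rfl⟩⟩ := huv
    · simpa using h.2 p hp
    · simpa using (h.2 p hp).symm

/-- **Dictionary lemma.** `hom_{E,m}` at the `0/1` adjacency matrix of a simple graph `X` on `Fin m` is the number
of graph homomorphisms from the pattern graph of `E` to `X`. [cite: DwivediPagoSeppelt2026, eq. (1)] -/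
theorem eval_indicator_homPoly {a b m : ℕ} (E : Multiset (Fin a × Fin b)) (Γ : SimpleGraph (Fin m)) :
    MvPolynomial.eval (Set.indicator {ij : Fin m × Fin m | Γ.Adj ij.1 ij.2} 1) (homPoly E m ℂ) =
      (Nat.card (patternGraph E →g Γ) : ℂ) := by
  classical
  have hind : ∀ ij : Fin m × Fin m,
      Set.indicator {ij : Fin m × Fin m | Γ.Adj ij.1 ij.2} (1 : Fin m × Fin m → ℂ) ij =
        if Γ.Adj ij.1 ij.2 then 1 else 0 := by
    intro ij
    by_cases h : Γ.Adj ij.1 ij.2 <;> simp [Set.indicator, h]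
  unfold homPoly
  rw [map_sum]
  have hterm : ∀ h : (Fin a → Fin m) × (Fin b → Fin m),
      MvPolynomial.eval (Set.indicator {ij : Fin m × Fin m | Γ.Adj ij.1 ij.2} 1)
          ((E.map fun e => (X (h.1 e.1, h.2 e.2) : MvPolynomial (Fin m × Fin m) ℂ)).prod) =
        if ∀ e ∈ E, Γ.Adj (h.1 e.1) (h.2 e.2) then 1 else 0 := by
    intro h
    rw [map_multiset_prod, Multiset.map_map]
    have : (E.map (Function.comp (MvPolynomial.eval (Set.indicator {ij : Fin m × Fin m | Γ.Adj ij.1 ij.2} 1))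
        fun e => (X (h.1 e.1, h.2 e.2) : MvPolynomial (Fin m × Fin m) ℂ))) =
        E.map fun e => (if Γ.Adj (h.1 e.1) (h.2 e.2) then (1 : ℂ) else 0) := by
      refine Multiset.map_congr rfl fun e _ => ?_
      simp only [Function.comp_apply, MvPolynomial.eval_X, hind]
    rw [this, prod_map_ite_one_zero]
    congr
  simp_rw [hterm]
  rw [natCard_hom_patternGraph, Nat.card_eq_fintype_card, Fintype.card_subtype,
    Finset.natCast_card_filter]

/-! ### Dvořák: `C^k`-equivalent simple graphs are `HomIndist`-indistinguishable at their adjacency matrices -/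

/-- **`C^k`-equivalence ⇒ two-sorted hom-indistinguishability of the adjacency matrices below treewidth `k`.**
For simple graphs `X ≡^{C^k} Y` on `Fin m`, every homomorphism polynomial of a bipartite multigraph pattern whose
pattern graph has treewidth `< k` takes the same value at the two `0/1` adjacency matrices — Dvořák's theorem
(tree: `Dvorak2010.card_hom_eq_of_ckEquiv`) through the dictionary lemma. [cite: Dvorak2010, Thm 6] -/
theorem homIndist_indicator_of_ckEquiv {k m : ℕ} {X Y : SimpleGraph (Fin m)} (h : CkEquiv k X Y) :
    HomIndist m k (Set.indicator {ij : Fin m × Fin m | X.Adj ij.1 ij.2} 1)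
      (Set.indicator {ij : Fin m × Fin m | Y.Adj ij.1 ij.2} 1) := by
  classical
  intro a b E htw
  rw [eval_indicator_homPoly, eval_indicator_homPoly]
  rcases Nat.eq_zero_or_pos k with hk | hk
  · omega
  obtain ⟨j, D, hD⟩ := Literature.Combinatorics.SimpleGraph.exists_width_eq_treewidth (patternGraph E)
  have hcard := Dvorak2010.card_hom_eq_of_ckEquiv (F := patternGraph E) hk h D fun t => by
    have := D.card_bag_le_width_add_one t
    omega
  exact_mod_cast hcard

/-- **Registered two-sorted determination ⇒ simple-graph determination (same exponent).**  A family that is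
`PolylogHomDetermined` (line `linear_width`, Theorems-side vocabulary) takes equal values at the adjacency
matrices of `≡^{C^{(log₂ m + c)^c}}`-equivalent simple graphs, at EVERY order `m`. [folklore] -/
theorem ckDetermined_of_polylogHomDetermined (f : (n : ℕ) → MvPolynomial (Fin n × Fin n) ℂ)
    (h : PolylogHomDetermined f) :
    ∃ c : ℕ, ∀ (m : ℕ) (X Y : SimpleGraph (Fin m)), CkEquiv ((Nat.log 2 m + c) ^ c) X Y →
      MvPolynomial.eval (Set.indicator {ij : Fin m × Fin m | X.Adj ij.1 ij.2} 1) (f m) =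
        MvPolynomial.eval (Set.indicator {ij : Fin m × Fin m | Y.Adj ij.1 ij.2} 1) (f m) := by
  obtain ⟨c, hc⟩ := h
  exact ⟨c, fun m X Y hXY => hc m _ _ (homIndist_indicator_of_ckEquiv hXY)⟩

/-! ### The lossless simple-graph cut of L1 -/

/-- **L1 ⟺ W₁ ∧ H₁ (the lossless simple-graph cut).**  `OrbitRestorationQP` holds iff
(W₁) every matrix-symmetric `VP` family that is EVENTUALLY `C^{(log₂ m + c)^c}`-determined on simple graphs has
square-symmetric circuits of quasi-polynomial orbit size, AND (H₁) every matrix-symmetric `VP` family IS eventually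
so determined.  `⟹`: H₁ is the contrapositive of the orbit-form kill engine
`not_qpOrbitSymmetric_of_polylogSeparating` (a family violating H₁ is polylog-separating), W₁ is L1 with an idle
hypothesis; `⟸`: composition.  In this currency nothing is lost: the two halves are each implied by L1.
[cite: DawarWilsenach2025, Thm 5.1, §6; AndersonDawar2016, Thm 6] -/
theorem orbitRestorationQP_iff_simpleGraphCut :
    OrbitRestorationQP ↔
      ((∀ f : (n : ℕ) → MvPolynomial (Fin n × Fin n) ℂ, IsMatrixSymmetric f → IsVPFamily f →
          (∃ c N : ℕ, ∀ m : ℕ, N ≤ m → ∀ X Y : SimpleGraph (Fin m),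
            CkEquiv ((Nat.log 2 m + c) ^ c) X Y →
              MvPolynomial.eval (Set.indicator {ij : Fin m × Fin m | X.Adj ij.1 ij.2} 1) (f m) =
                MvPolynomial.eval (Set.indicator {ij : Fin m × Fin m | Y.Adj ij.1 ij.2} 1) (f m)) →
          QPOrbitSymm f) ∧
        ∀ f : (n : ℕ) → MvPolynomial (Fin n × Fin n) ℂ, IsMatrixSymmetric f → IsVPFamily f →
          ∃ c N : ℕ, ∀ m : ℕ, N ≤ m → ∀ X Y : SimpleGraph (Fin m),
            CkEquiv ((Nat.log 2 m + c) ^ c) X Y →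
              MvPolynomial.eval (Set.indicator {ij : Fin m × Fin m | X.Adj ij.1 ij.2} 1) (f m) =
                MvPolynomial.eval (Set.indicator {ij : Fin m × Fin m | Y.Adj ij.1 ij.2} 1) (f m)) := by
  constructor
  · intro hL1
    refine ⟨fun f hs hVP _ => hL1 f hs hVP, fun f hs hVP => ?_⟩
    by_contra hdet
    push Not at hdet
    exact not_qpOrbitSymmetric_of_polylogSeparating f hdet (hL1 f hs hVP)
  · rintro ⟨hW, hH⟩ f hs hVP
    exact hW f hs hVP (hH f hs hVP)

/-- **H₁ alone is necessary**: L1 forces every matrix-symmetric `VP` family to be eventually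
`C^{polylog}`-determined on simple graphs (the finite-model-theory half; its failure for ONE family is
`PolylogWidthVP`, which refutes L1). [cite: DawarWilsenach2025, §6, §8] -/
theorem simpleGraphHalf_of_orbitRestorationQP (hL1 : OrbitRestorationQP)
    (f : (n : ℕ) → MvPolynomial (Fin n × Fin n) ℂ) (hs : IsMatrixSymmetric f) (hVP : IsVPFamily f) :
    ∃ c N : ℕ, ∀ m : ℕ, N ≤ m → ∀ X Y : SimpleGraph (Fin m),
      CkEquiv ((Nat.log 2 m + c) ^ c) X Y →
        MvPolynomial.eval (Set.indicator {ij : Fin m × Fin m | X.Adj ij.1 ij.2} 1) (f m) =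
          MvPolynomial.eval (Set.indicator {ij : Fin m × Fin m | Y.Adj ij.1 ij.2} 1) (f m) :=
  (orbitRestorationQP_iff_simpleGraphCut.mp hL1).2 f hs hVP

/-! ### The registered cut versus the lossless one -/

/-- **Registered GAP 2 ⇒ H₁.**  `stub_homDeterminedVP`'s statement (every matrix-symmetric `VP` family is
`PolylogHomDetermined`, Theorems-side vocabulary) implies the lossless finite-model-theory half H₁, with threshold
`N = 0`. So GAP 2 as registered is AT LEAST as strong as what L1 yields. [folklore] -/
theorem simpleGraphHalf_of_homDeterminedVP
    (hGAP2 : ∀ f : (n : ℕ) → MvPolynomial (Fin n × Fin n) ℂ,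
      IsMatrixSymmetric f → IsVPFamily f → PolylogHomDetermined f) :
    ∀ f : (n : ℕ) → MvPolynomial (Fin n × Fin n) ℂ, IsMatrixSymmetric f → IsVPFamily f →
      ∃ c N : ℕ, ∀ m : ℕ, N ≤ m → ∀ X Y : SimpleGraph (Fin m),
        CkEquiv ((Nat.log 2 m + c) ^ c) X Y →
          MvPolynomial.eval (Set.indicator {ij : Fin m × Fin m | X.Adj ij.1 ij.2} 1) (f m) =
            MvPolynomial.eval (Set.indicator {ij : Fin m × Fin m | Y.Adj ij.1 ij.2} 1) (f m) := by
  intro f hs hVP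
  obtain ⟨c, hc⟩ := ckDetermined_of_polylogHomDetermined f (hGAP2 f hs hVP)
  exact ⟨c, 0, fun m _ X Y hXY => hc m X Y hXY⟩

/-- **W₁ ⇒ the registered width half.**  The lossless circuit half W₁ (eventual simple-graph determination ⇒
quasi-polynomial orbits) implies `WidthRestorationQP` of the skeleton (unfolded: `PolylogHomDetermined ⇒ QPOrbitSymm`
for matrix-symmetric `VP` families), hence every rung `WidthRung d`. [folklore] -/
theorem widthRestoration_of_simpleGraphW
    (hW : ∀ f : (n : ℕ) → MvPolynomial (Fin n × Fin n) ℂ, IsMatrixSymmetric f → IsVPFamily f →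
      (∃ c N : ℕ, ∀ m : ℕ, N ≤ m → ∀ X Y : SimpleGraph (Fin m),
        CkEquiv ((Nat.log 2 m + c) ^ c) X Y →
          MvPolynomial.eval (Set.indicator {ij : Fin m × Fin m | X.Adj ij.1 ij.2} 1) (f m) =
            MvPolynomial.eval (Set.indicator {ij : Fin m × Fin m | Y.Adj ij.1 ij.2} 1) (f m)) →
      QPOrbitSymm f) :
    ∀ f : (n : ℕ) → MvPolynomial (Fin n × Fin n) ℂ,
      IsMatrixSymmetric f → IsVPFamily f → PolylogHomDetermined f → QPOrbitSymm f := by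
  intro f hs hVP hdet
  obtain ⟨c, hc⟩ := ckDetermined_of_polylogHomDetermined f hdet
  exact hW f hs hVP ⟨c, 0, fun m _ X Y hXY => hc m X Y hXY⟩

/-- Hence W₁ gives every rung of the graded family `WidthRung d` of line `linear_width`. [folklore] -/
theorem widthRung_of_simpleGraphW
    (hW : ∀ f : (n : ℕ) → MvPolynomial (Fin n × Fin n) ℂ, IsMatrixSymmetric f → IsVPFamily f →
      (∃ c N : ℕ, ∀ m : ℕ, N ≤ m → ∀ X Y : SimpleGraph (Fin m),
        CkEquiv ((Nat.log 2 m + c) ^ c) X Y →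
          MvPolynomial.eval (Set.indicator {ij : Fin m × Fin m | X.Adj ij.1 ij.2} 1) (f m) =
            MvPolynomial.eval (Set.indicator {ij : Fin m × Fin m | Y.Adj ij.1 ij.2} 1) (f m)) →
      QPOrbitSymm f) (d : ℕ → ℕ) :
    WidthRung d :=
  widthRung_of_top (widthRestoration_of_simpleGraphW hW) d

/-- **L1 from the MIXED cut**: the lossless circuit half W₁ together with the registered GAP 2 already gives L1
(GAP 2 ⇒ H₁, then `orbitRestorationQP_iff_simpleGraphCut`). [folklore] -/
theorem orbitRestorationQP_of_simpleGraphW_of_homDeterminedVP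
    (hW : ∀ f : (n : ℕ) → MvPolynomial (Fin n × Fin n) ℂ, IsMatrixSymmetric f → IsVPFamily f →
      (∃ c N : ℕ, ∀ m : ℕ, N ≤ m → ∀ X Y : SimpleGraph (Fin m),
        CkEquiv ((Nat.log 2 m + c) ^ c) X Y →
          MvPolynomial.eval (Set.indicator {ij : Fin m × Fin m | X.Adj ij.1 ij.2} 1) (f m) =
            MvPolynomial.eval (Set.indicator {ij : Fin m × Fin m | Y.Adj ij.1 ij.2} 1) (f m)) →
      QPOrbitSymm f)
    (hGAP2 : ∀ f : (n : ℕ) → MvPolynomial (Fin n × Fin n) ℂ,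
      IsMatrixSymmetric f → IsVPFamily f → PolylogHomDetermined f) :
    OrbitRestorationQP :=
  orbitRestorationQP_iff_simpleGraphCut.mpr ⟨hW, simpleGraphHalf_of_homDeterminedVP hGAP2⟩

/-! ### The floor of H₁: polylogarithmic degree -/

/-- **Floor.** A matrix-symmetric family of polylogarithmic total degree satisfies H₁ (indeed at every order,
`N = 0`), with NO `VP` hypothesis: it is `PolylogHomDetermined`
(`DeterminedVsNarrow.polylogHomDetermined_of_polylogDegree`), then the bridge. [folklore] -/
theorem simpleGraphHalf_of_polylogDegree (f : (n : ℕ) → MvPolynomial (Fin n × Fin n) ℂ)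
    (hs : IsMatrixSymmetric f) (hdeg : ∃ c : ℕ, ∀ n : ℕ, (f n).totalDegree ≤ (Nat.log 2 n + c) ^ c) :
    ∃ c N : ℕ, ∀ m : ℕ, N ≤ m → ∀ X Y : SimpleGraph (Fin m),
      CkEquiv ((Nat.log 2 m + c) ^ c) X Y →
        MvPolynomial.eval (Set.indicator {ij : Fin m × Fin m | X.Adj ij.1 ij.2} 1) (f m) =
          MvPolynomial.eval (Set.indicator {ij : Fin m × Fin m | Y.Adj ij.1 ij.2} 1) (f m) := by
  obtain ⟨c, hc⟩ := ckDetermined_of_polylogHomDetermined f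
    (DeterminedVsNarrow.polylogHomDetermined_of_polylogDegree f hs hdeg)
  exact ⟨c, 0, fun m _ X Y hXY => hc m X Y hXY⟩

end SimpleGraphCut

end Summit.ValiantsHypothesis.ValiantsHypothesis.Theorems

end
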